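import Literature.MathematicalPhysics.QuantumFieldTheory.Balaban1983to89.Node00.HistoryRecursionOfRecord
import Literature.MathematicalPhysics.QuantumFieldTheory.Balaban1983to89.B13Lemma3TorusTerms

/-!
# NODE 00 (YM-PLAN Track A) — W1 = [II] §2 (2.13)–(2.14), STOREY 6: THE ONE-STEP GENERATOR IN PRINT'S TERM INDEX
# (`W1.TermLabel`, `W1.TermFun`, `W1.StepGen.ofTerms`, `W1.GenTower.ofTerms`; the activity and (2.13) as sums over print's terms `(𝐃, P)` of
# `B13Lemma3TorusTerms.terms L M Z`; the index maps of the Summit-side per-term schemas DISCHARGED; every injecting generator IS a term-indexed one)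

NODE 00 DEFINER MODULE (seat `pub-ymgap-node00-def-W1`, generation 6, 2026-08-27).  APPEND-ONLY: a NEW importing module; g4∕g5's
`Node00/HistoryRecursionOfRecord` (`StepGen`, `GenTower`, `recTerm`, `toClusterTower`) and `B13Lemma3TorusTerms` (`terms`, `weight`) untouched and CONSUMED
BY NAME.  [II] = [Balaban1988RG2Cluster] T. Bałaban, *Renormalization group approach to lattice gauge field theories. II. Cluster expansions*, Commun.
Math. Phys. **116** (1988) 1–22; [I] = [Balaban1987RG1], part I, Commun. Math. Phys. **109** (1987) 249–301.

THE PIN.  g4's one-step generator `StepGen P 𝔸 M k` types the step-`k` cluster data with a FREE index type `Idx` and the generic term (2.14) as a function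
`T i t old φ` of the last coupling `t = g_k`, the older terms `old = (E^{(j)})_{j ≤ k}` and the configuration `φ`; the activity is `H(Z) = Σ_{i ∈ idx Z} T i`
((2.11)).  In print the indices ARE the pairs `(𝐃, P)` of (2.1), (2.3), (2.9) — on the record's torus catalogue the finite set
`B13Lemma3TorusTerms.terms L M Z` of `B13Lemma3TorusTerms.IsTerm L M Z` pairs (𝐃 a family of `M`-cube domains of the `L`-times finer torus of level `k`,
P a set of its bonds) — and the Summit-side per-term schemas of node N22 (`…N22W1StripGeneratorTermwise` §1 `stepSchema226_of_termwise`,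
`…N22W1StripLastTermwise` §2 `stepSchemaLast_of_termwiseIdx`) are stated for a generator TOGETHER WITH index maps `e Z : Idx → (pairs)` INTO `terms L M Z`,
injective on `idx Z`.  THIS STOREY TYPES THE GENERATOR WHOSE INDEX SET IS PRINT'S:
* `TermLabel P M k L` — the type of the pairs `t = (𝐃, P)` at step `k` (block factor `L`: level `k` has `L · domCount P M (k+1)` cubes per direction);
* `TermFun P 𝔸 M k L := (Z : 𝐃_{k+1}) → TermLabel → ℂ → OlderTerms P 𝔸 M k → CPair P 𝔸 → ℂ` — a TERM FUNCTIONAL: the value of the (2.14) term of `Z`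
  labelled `t`, as a function of (last coupling, older terms, configuration) — THE ONE PARAMETER of the generator of record (the (2.14) formula itself is
  node00-def-B13's `Node00/CarriersB13KernelTower` `ResidB13K.T₃` over NODE A's kernels; its reading as a `TermFun` — [II] §1 (1.33)∕(1.41): older terms ↦
  potentials `𝐕_k(Y, B)` — is NOT typed here and stays displayed);
* **`StepGen.ofTerms L T : StepGen P 𝔸 M k`** — `Idx := 𝐃_{k+1} × TermLabel`, `idx Z := {Z} × terms L M Z`, `T (Z, t) := T Z t`; `GenTower.ofTerms L T` step-wise.
Then (all `rfl` ∕ `Finset.sum_map` ∕ the triangle inequality ∕ finite sums of holomorphic functions):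
* `ofTerms_H` — **`H(Z) = Σ_{(𝐃,P) ∈ terms L M Z} T Z (𝐃,P) g_k old φ`** ((2.9)∕(2.11) with print's index set); `ofTerms_E` ((2.13) over these activities);
  `toClusterTower_ofTerms_H`, **`recTerm_ofTerms_succ`** — THE W1 RECURSION (2.13) WITH PRINT'S TERM SUM: `E^{(k+1)}(X; g) = locE (Z ↦ Σ_{(𝐃,P) ∈ terms} T …
  (g_k, (E^{(j)}(g))_{j≤k}, φ)) X`;
* `mem_idx_ofTerms_iff`, `forall_mem_idx_ofTerms_iff`, **`snd_mem_terms_of_mem_idx`**, **`injOn_snd_idx`** — the index maps of the Summit-side per-term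
  schemas DISCHARGED at `e := fun _ i => i.2` (into `terms`, injective on `idx Z`), so those schemas read «for every `t ∈ terms L M Z`» verbatim;
* `norm_H_ofTerms_le` (‖H(Z)‖ ≤ Σ_{t ∈ terms} ‖T Z t …‖ — the domination clause of (S-226) with `Tt Z t z := T Z t ↑s (cv z) φ` canonically),
  `differentiableOn_H_ofTerms` ∕ `analyticOnNhd_H_ofTerms` (holomorphy of the activity along any curve in (last coupling, older terms, configuration) from
  the terms'), `H_ofTerms_congr` (per-term localisation ⟹ (S-loc)-type congruences of the activity);
* UNIVERSALITY: `StepGen.fibreTermFun G e` (fibre sums of a generator's terms over index maps `e` into print's pairs) with **`H_ofTerms_fibreTermFun`** ∕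
  `E_ofTerms_fibreTermFun` — under «`e Z` maps `idx Z` into `terms L M Z`» the term-indexed generator of the fibre sums has THE SAME activities and the same
  (2.13) as `G` (`Finset.sum_fiberwise_of_maps_to`; injectivity not needed): the index-map currency of the Summit-side schemas loses and gains nothing
  against this one;
* HONESTY: `ofTerms_zero_H` ∕ `ofTerms_zero_E` ∕ **`recTerm_ofTerms_zero`** — at the zero term functional every activity, every (2.13) and EVERY GENERATED
  TERM vanishes (g0's zero-tower species `LOCATED-N10-ZEROTOWER` in this currency): the junction pins the INDEX SET and the SHAPE «term = function of
  (g_k, older terms, φ)», NOTHING analytic — (S-loc)∕(S-226)∕(S-last) per term are properties of the term functional OF RECORD, displayed downstream.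

CONSUMER RECIPE (Summits side; NOT this module — Literature does not import Summits; KERNEL-CHECKED before filing in a scratch against the binder shapes of
`…N22W1StripGeneratorTermwise` §1 and `…N22W1StripLastTermwise` §2 as landed, `(F.P k).d ≡ 4` by unfolding): with `Gn F θ k := GenTower.ofTerms L (TF F θ k)` for a
term-functional family `TF F θ k : GenTermFun (F.P k) (MatA N) θ.τ9.M L`, instantiate `stepSchema226_of_termwise k Sg Rz (StepGen.ofTerms L T) c hA6 (fun _ i => i.2)
(fun Z _ hi => snd_mem_terms_of_mem_idx L T Z hi) (fun Z => injOn_snd_idx L T Z) (fun D hD hdisc s hs cv hcv X φ hφ Z hZ => (forall_mem_idx_ofTerms_iff L T Z).2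
(h226T' D hD hdisc s hs cv hcv X φ hφ Z hZ))` where `h226T'` is (S-226-T) stated over `t ∈ terms L M Z` with the term `z ↦ T Z t ↑s (cv z) φ` and the weight
`weight L M c Z a t` (print's, no index map); likewise `stepSchemaLast_of_termwiseIdx` with `e := fun k′ _ i => i.2`, `he := fun k′ _ Z _ hi =>
snd_mem_terms_of_mem_idx L (T k′) Z hi`, `hinj := fun k′ _ Z => injOn_snd_idx L (T k′) Z`.

HONEST FRAMING: definitions + kernel bookkeeping (`rfl`, `Finset.sum_map`, re-indexing, the triangle inequality, finite sums of holomorphic functions, one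
vanishing); NO estimate; nothing of Bałaban's asserted or constructed; the term functional is DATA (no law); N22 ∕ N10 NOT discharged; K3‴ untouched; counts
unmoved; one finite 𝕋⁴ programme at fixed ε, Bałaban as printed — NOT continuum ∕ ℝ⁴ ∕ infinite volume ∕ OS ∕ mass gap ∕ Clay.  No `sorry`, no `axiom`,
no `instance`, no `notation`.

References (TYPES and page anchors only): [II] (2.1)–(2.3) p.12, (2.9)–(2.14) pp.14–15, (2.26) p.17; [I] (0.23) p.256, (2.12)–(2.13) p.268.
-/

open scoped BigOperators

noncomputable section

namespace Literature.MathematicalPhysics.QuantumFieldTheory.Balaban1983to89.Node00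

open Literature.MathematicalPhysics.QuantumFieldTheory.Balaban1983to89
open Step B14.Eq213MaximalDomains TreeLengthTorus T4Continuum Sect2
open Literature.MathematicalPhysics.QuantumFieldTheory.Balaban1983to89.TreeLengthTorusGeometry (tgeometry)
open Literature.MathematicalPhysics.QuantumFieldTheory.Balaban1983to89.B13Lemma3TorusData (TBond)
open Literature.MathematicalPhysics.QuantumFieldTheory.Balaban1983to89.B13Lemma3TorusTerms (terms)

namespace W1

/-! ## §1  Print's term labels `(𝐃, P)` and term functionals -/

section Labels

/-- **PRINT'S TERM LABELS AT STEP `k`**: the pairs `t = (𝐃, P)` — `𝐃` a finite family of domains of the level-`k` torus catalogue (`L · domCount P M (k+1)`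
`M`-cubes per direction), `P` a finite set of its bonds — the ambient type of `B13Lemma3TorusTerms.terms L M Z`, `Z ∈ 𝐃_{k+1}` (the sums of (2.9), (2.1),
(2.3) «over Z₀, 𝐃, P», Z₀ determined by P). [cite: Balaban1988RG2Cluster, (2.1)-(2.3) p.12 and (2.9) p.14] -/
abbrev TermLabel (P : Params) (M k L : ℕ) [NeZero L] : Type :=
  Finset (TDom P.d (L * domCount P M (k + 1))) × Finset (TBond P.d M (L * domCount P M (k + 1)))

/-- **A TERM FUNCTIONAL AT STEP `k`**: the value of the (2.14) term of `Z ∈ 𝐃_{k+1}` labelled `t = (𝐃, P)` as a function of the LAST coupling `g_k`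
(complex), the OLDER TERMS `(E^{(j)})_{j ≤ k}` (print: through the potentials `𝐕_k(Y, B)` of (1.41) in `exp[Σ_{Y∈𝐃} τ(Y)𝐕_k(Y, B)]`) and the configuration
`φ = (𝐔, 𝐉)` — DATA, no law (the parameter of the generator of record). [cite: Balaban1988RG2Cluster, (2.14) p.15 and (1.41) p.11; Balaban1987RG1, (2.12)-(2.13) p.268] -/
abbrev TermFun (P : Params) (𝔸 : Type*) (M k L : ℕ) [NeZero L] :=
  (domSys P M (k + 1)).Dom → TermLabel P M k L → ℂ → OlderTerms P 𝔸 M k → CPair P 𝔸 → ℂ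

/-- **A TERM-FUNCTIONAL FAMILY**: one term functional per step `k = 0, 1, 2, …`. [cite: Balaban1987RG1, (2.12)-(2.13) p.268 (every step)] -/
abbrev GenTermFun (P : Params) (𝔸 : Type*) (M L : ℕ) [NeZero L] := (k : ℕ) → TermFun P 𝔸 M k L

end Labels

/-! ## §2  The one-step generator in print's term index -/

section OfTerms

variable {P : Params} {𝔸 : Type*} {M : ℕ} [NeZero M] {k : ℕ} (L : ℕ) [NeZero L]

/-- **THE ONE-STEP GENERATOR IN PRINT'S TERM INDEX**: indices at `Z` = the pairs `(Z, t)`, `t ∈ terms L M Z` (print's (𝐃, P) localizing at `Z`, (2.10));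
generic term = the term functional (`reducible`: the index type unfolds to the pairs for consumers' `e := fun _ i => i.2`).
[cite: Balaban1988RG2Cluster, (2.9)-(2.11) p.14 and (2.14) p.15] -/
@[reducible] def StepGen.ofTerms (T : TermFun P 𝔸 M k L) : StepGen P 𝔸 M k where
  Idx := (domSys P M (k + 1)).Dom × TermLabel P M k L
  idx Z := (terms L M Z).map (Function.Embedding.sectR Z (TermLabel P M k L))
  T i := T i.1 i.2

/-- Face: the generic term of the term-indexed generator (`rfl`). [cite: Balaban1988RG2Cluster, (2.14) p.15 (bookkeeping)] -/
@[simp] theorem ofTerms_T (T : TermFun P 𝔸 M k L) (i : (StepGen.ofTerms L T).Idx) (t : ℂ) (old : OlderTerms P 𝔸 M k) (φ : CPair P 𝔸) :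
    (StepGen.ofTerms L T).T i t old φ = T i.1 i.2 t old φ := rfl

/-- Face: the indices localizing at `Z` are `{Z} × terms L M Z` (`rfl`). [cite: Balaban1988RG2Cluster, (2.10) p.14 (bookkeeping)] -/
theorem ofTerms_idx (T : TermFun P 𝔸 M k L) (Z : (domSys P M (k + 1)).Dom) :
    (StepGen.ofTerms L T).idx Z = (terms L M Z).map (Function.Embedding.sectR Z (TermLabel P M k L)) := rfl

/-- Membership in the indices at `Z`: first component `Z`, second a term of `Z`. [cite: Balaban1988RG2Cluster, (2.9)-(2.10) p.14 (bookkeeping)] -/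
theorem mem_idx_ofTerms_iff (T : TermFun P 𝔸 M k L) {Z : (domSys P M (k + 1)).Dom} {i : (StepGen.ofTerms L T).Idx} :
    i ∈ (StepGen.ofTerms L T).idx Z ↔ i.1 = Z ∧ i.2 ∈ terms L M Z := by
  constructor
  · intro h
    obtain ⟨t, ht, rfl⟩ := Finset.mem_map.1 h
    exact ⟨rfl, ht⟩
  · rintro ⟨h1, h2⟩
    exact Finset.mem_map.2 ⟨i.2, h2, Prod.ext h1.symm rfl⟩

/-- A statement over the indices at `Z` is the statement over print's terms of `Z`. [cite: Balaban1988RG2Cluster, (2.9)-(2.10) p.14 (bookkeeping)] -/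
theorem forall_mem_idx_ofTerms_iff (T : TermFun P 𝔸 M k L) (Z : (domSys P M (k + 1)).Dom) {Q : (StepGen.ofTerms L T).Idx → Prop} :
    (∀ i ∈ (StepGen.ofTerms L T).idx Z, Q i) ↔ ∀ t ∈ terms L M Z, Q (Z, t) := by
  constructor
  · intro h t ht
    exact h (Z, t) (Finset.mem_map_of_mem _ ht)
  · intro h i hi
    obtain ⟨t, ht, rfl⟩ := Finset.mem_map.1 hi
    exact h t ht

/-- **THE INDEX MAP `i ↦ i.2` LANDS IN PRINT'S TERM SET** (the Summit-side per-term schemas' `he` at `e := fun _ i => i.2`).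
[cite: Balaban1988RG2Cluster, (2.9) p.14 and (2.14) p.15] -/
theorem snd_mem_terms_of_mem_idx (T : TermFun P 𝔸 M k L) (Z : (domSys P M (k + 1)).Dom) {i : (StepGen.ofTerms L T).Idx}
    (h : i ∈ (StepGen.ofTerms L T).idx Z) : i.2 ∈ terms L M Z :=
  ((mem_idx_ofTerms_iff L T).1 h).2

/-- The indices at `Z` have first component `Z`. [cite: Balaban1988RG2Cluster, (2.10) p.14 (bookkeeping)] -/
theorem fst_eq_of_mem_idx (T : TermFun P 𝔸 M k L) (Z : (domSys P M (k + 1)).Dom) {i : (StepGen.ofTerms L T).Idx}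
    (h : i ∈ (StepGen.ofTerms L T).idx Z) : i.1 = Z :=
  ((mem_idx_ofTerms_iff L T).1 h).1

/-- **THE INDEX MAP `i ↦ i.2` IS INJECTIVE ON THE INDICES AT `Z`** (the Summit-side per-term schemas' `hinj` at `e := fun _ i => i.2`).
[cite: Balaban1988RG2Cluster, (2.9) p.14 and (2.14) p.15] -/
theorem injOn_snd_idx (T : TermFun P 𝔸 M k L) (Z : (domSys P M (k + 1)).Dom) :
    Set.InjOn (fun i : (StepGen.ofTerms L T).Idx => i.2) ↑((StepGen.ofTerms L T).idx Z) := by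
  intro i hi j hj hij
  exact Prod.ext ((fst_eq_of_mem_idx L T Z hi).trans (fst_eq_of_mem_idx L T Z hj).symm) hij

/-- **THE ACTIVITY IS THE SUM OVER PRINT'S TERMS**: `H(Z)(g_k, old, φ) = Σ_{(𝐃,P) ∈ terms L M Z} T Z (𝐃,P) g_k old φ` — (2.9)∕(2.11) with the index set
of print. [cite: Balaban1988RG2Cluster, (2.9)-(2.11) p.14] -/
theorem ofTerms_H (T : TermFun P 𝔸 M k L) (t : ℂ) (old : OlderTerms P 𝔸 M k) (φ : CPair P 𝔸) (Z : (domSys P M (k + 1)).Dom) :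
    (StepGen.ofTerms L T).H t old φ Z = ∑ s ∈ terms L M Z, T Z s t old φ := by
  show ∑ i ∈ (terms L M Z).map (Function.Embedding.sectR Z (TermLabel P M k L)), T i.1 i.2 t old φ = _
  rw [Finset.sum_map]
  rfl

open Classical in
/-- **(2.13) OF THE TERM-INDEXED GENERATOR**: `E^{(k+1)}(X) = locE (Z ↦ Σ_{(𝐃,P) ∈ terms L M Z} T …) X` — the Kotecký–Preiss literal over the term sums.
[cite: Balaban1988RG2Cluster, (2.13) p.14] -/
theorem ofTerms_E (T : TermFun P 𝔸 M k L) (t : ℂ) (old : OlderTerms P 𝔸 M k) (φ : CPair P 𝔸) (X : (domSys P M (k + 1)).Dom) :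
    (StepGen.ofTerms L T).E t old φ X =
      B13Resummation.locE (tgeometry P.d (domCount P M (k + 1))).ι (tgeometry P.d (domCount P M (k + 1))).cubes
        (fun Z => ∑ s ∈ terms L M Z, T Z s t old φ) (Subtype.val X) := by
  unfold StepGen.E
  exact congrArg (fun w => B13Resummation.locE _ (tgeometry P.d (domCount P M (k + 1))).cubes w (Subtype.val X))
    (funext fun Z => ofTerms_H L T t old φ Z)

/-- **DOMINATION BY THE TERM SUM** (the triangle inequality): `‖H(Z)‖ ≤ Σ_{t ∈ terms L M Z} ‖T Z t …‖` — the domination clause of the older-terms schema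
with the complexified term values `Tt Z t z := T Z t ↑s (cv z) φ` canonically. [cite: Balaban1988RG2Cluster, (2.9) p.14 and (2.26) p.17] -/
theorem norm_H_ofTerms_le (T : TermFun P 𝔸 M k L) (t : ℂ) (old : OlderTerms P 𝔸 M k) (φ : CPair P 𝔸) (Z : (domSys P M (k + 1)).Dom) :
    ‖(StepGen.ofTerms L T).H t old φ Z‖ ≤ ∑ s ∈ terms L M Z, ‖T Z s t old φ‖ := by
  rw [ofTerms_H]
  exact norm_sum_le _ _

/-- **HOLOMORPHY OF THE ACTIVITY FROM THE TERMS'** along any curve `z ↦ (u z, cv z, cφ z)` in (last coupling, older terms, configuration): a finite sum of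
holomorphic functions. [cite: Balaban1988RG2Cluster, (2.9) p.14 and (2.26) p.17; Balaban1987RG1, p.266] -/
theorem differentiableOn_H_ofTerms (T : TermFun P 𝔸 M k L) {D : Set ℂ} (u : ℂ → ℂ) (cv : ℂ → OlderTerms P 𝔸 M k) (cφ : ℂ → CPair P 𝔸)
    (Z : (domSys P M (k + 1)).Dom) (h : ∀ s ∈ terms L M Z, DifferentiableOn ℂ (fun z => T Z s (u z) (cv z) (cφ z)) D) :
    DifferentiableOn ℂ (fun z => (StepGen.ofTerms L T).H (u z) (cv z) (cφ z) Z) D := by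
  simp only [ofTerms_H]
  exact DifferentiableOn.fun_sum h

/-- Analyticity of the activity from the terms' along any curve (the `AnalyticOnNhd` currency of g4's (A-last)∕(A-prop)).
[cite: Balaban1988RG2Cluster, (2.9) p.14 and (2.26) p.17; Balaban1987RG1, p.266] -/
theorem analyticOnNhd_H_ofTerms (T : TermFun P 𝔸 M k L) {D : Set ℂ} (u : ℂ → ℂ) (cv : ℂ → OlderTerms P 𝔸 M k) (cφ : ℂ → CPair P 𝔸)
    (Z : (domSys P M (k + 1)).Dom) (h : ∀ s ∈ terms L M Z, AnalyticOnNhd ℂ (fun z => T Z s (u z) (cv z) (cφ z)) D) :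
    AnalyticOnNhd ℂ (fun z => (StepGen.ofTerms L T).H (u z) (cv z) (cφ z) Z) D := by
  simp only [ofTerms_H]
  exact Finset.analyticOnNhd_fun_sum _ h

/-- **PER-TERM CONGRUENCE ⟹ CONGRUENCE OF THE ACTIVITY** (the (S-loc)-type clauses term by term: if every term of `Z` takes the same value at two
argument triples, so does `H(Z)`). [cite: Balaban1988RG2Cluster, (2.9)-(2.11) p.14 (bookkeeping)] -/
theorem H_ofTerms_congr {T T' : TermFun P 𝔸 M k L} {t t' : ℂ} {old old' : OlderTerms P 𝔸 M k} {φ φ' : CPair P 𝔸} (Z : (domSys P M (k + 1)).Dom)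
    (h : ∀ s ∈ terms L M Z, T Z s t old φ = T' Z s t' old' φ') :
    (StepGen.ofTerms L T).H t old φ Z = (StepGen.ofTerms L T').H t' old' φ' Z := by
  rw [ofTerms_H, ofTerms_H]
  exact Finset.sum_congr rfl h

end OfTerms

/-! ## §3  Universality: every generator whose indices map into print's terms is a term-indexed one -/

section Fibre

variable {P : Params} {𝔸 : Type*} {M : ℕ} [NeZero M] {k : ℕ} (L : ℕ) [NeZero L]

open Classical in
/-- **THE FIBRE TERM FUNCTIONAL** of a generator `G` under index maps `e Z : G.Idx → TermLabel`: the term labelled `t` of `Z` := the sum of `G`'s generic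
terms over the indices at `Z` sent to `t` (the Summit-side regrouping `Tt Z t z := Σ_{i ∈ idx Z, e Z i = t} T i …`, as a term functional).
[cite: Balaban1988RG2Cluster, (2.9)-(2.11) p.14 and (2.14) p.15] -/
def StepGen.fibreTermFun (G : StepGen P 𝔸 M k) (e : (domSys P M (k + 1)).Dom → G.Idx → TermLabel P M k L) : TermFun P 𝔸 M k L :=
  fun Z s t old φ => ∑ i ∈ (G.idx Z).filter (fun i => e Z i = s), G.T i t old φ

omit [NeZero M] in
open Classical in
/-- Face (`rfl`). [cite: Balaban1988RG2Cluster, (2.9)-(2.11) p.14 (bookkeeping)] -/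
theorem fibreTermFun_apply (G : StepGen P 𝔸 M k) (e : (domSys P M (k + 1)).Dom → G.Idx → TermLabel P M k L)
    (Z : (domSys P M (k + 1)).Dom) (s : TermLabel P M k L) (t : ℂ) (old : OlderTerms P 𝔸 M k) (φ : CPair P 𝔸) :
    G.fibreTermFun L e Z s t old φ = ∑ i ∈ (G.idx Z).filter (fun i => e Z i = s), G.T i t old φ := rfl

open Classical in
/-- **SAME ACTIVITIES**: if `e Z` maps the indices at `Z` INTO `terms L M Z`, the term-indexed generator of the fibre term functional has the activities of
`G` (regrouping a finite sum by its fibres; injectivity of `e Z` not needed). [cite: Balaban1988RG2Cluster, (2.9)-(2.11) p.14] -/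
theorem H_ofTerms_fibreTermFun (G : StepGen P 𝔸 M k) (e : (domSys P M (k + 1)).Dom → G.Idx → TermLabel P M k L)
    (he : ∀ (Z : (domSys P M (k + 1)).Dom), ∀ i ∈ G.idx Z, e Z i ∈ terms L M Z)
    (t : ℂ) (old : OlderTerms P 𝔸 M k) (φ : CPair P 𝔸) (Z : (domSys P M (k + 1)).Dom) :
    (StepGen.ofTerms L (G.fibreTermFun L e)).H t old φ Z = G.H t old φ Z := by
  rw [ofTerms_H]
  exact Finset.sum_fiberwise_of_maps_to (he Z) _

open Classical in
/-- **SAME (2.13)**: under the same hypothesis the two generators create the same term `E^{(k+1)}(X)` from the same arguments.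
[cite: Balaban1988RG2Cluster, (2.13) p.14] -/
theorem E_ofTerms_fibreTermFun (G : StepGen P 𝔸 M k) (e : (domSys P M (k + 1)).Dom → G.Idx → TermLabel P M k L)
    (he : ∀ (Z : (domSys P M (k + 1)).Dom), ∀ i ∈ G.idx Z, e Z i ∈ terms L M Z)
    (t : ℂ) (old : OlderTerms P 𝔸 M k) (φ : CPair P 𝔸) (X : (domSys P M (k + 1)).Dom) :
    (StepGen.ofTerms L (G.fibreTermFun L e)).E t old φ X = G.E t old φ X := by
  unfold StepGen.E
  exact congrArg (fun w => B13Resummation.locE _ (tgeometry P.d (domCount P M (k + 1))).cubes w (Subtype.val X))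
    (funext fun Z => H_ofTerms_fibreTermFun L G e he t old φ Z)

end Fibre

/-! ## §4  Towers: the generated history with print's term sums ((2.13) at every step) -/

section Towers

variable {P : Params} {𝔸 : Type*} {M : ℕ} [NeZero M] (L : ℕ) [NeZero L]

/-- **THE GENERATOR TOWER OF A TERM-FUNCTIONAL FAMILY** (step-wise `StepGen.ofTerms`). [cite: Balaban1987RG1, (2.12)-(2.13) p.268; Balaban1988RG2Cluster, (2.14) p.15] -/
def GenTower.ofTerms (T : GenTermFun P 𝔸 M L) : GenTower P 𝔸 M := fun k => StepGen.ofTerms L (T k)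

/-- Face (`rfl`). [cite: Balaban1987RG1, (2.12)-(2.13) p.268 (bookkeeping)] -/
@[simp] theorem GenTower.ofTerms_apply (T : GenTermFun P 𝔸 M L) (k : ℕ) : GenTower.ofTerms L T k = StepGen.ofTerms L (T k) := rfl

/-- **THE ACTIVITY OF THE GENERATED STEP WITH PRINT'S TERM SUM**: at the real young prefix `(g₀, …, g_k)`,
`H(Z) = Σ_{(𝐃,P) ∈ terms L M Z} T k Z (𝐃,P) g_k (E^{(j)}(g₀, …, g_{j−1}))_{j≤k} φ`. [cite: Balaban1988RG2Cluster, (2.9)-(2.11) p.14 and (2.14) p.15; Balaban1987RG1, (2.13) p.268] -/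
theorem toClusterTower_ofTerms_H (T : GenTermFun P 𝔸 M L) (k : ℕ) (gk : Fin (k + 1) → ℝ) (φ : CPair P 𝔸) (Z : (domSys P M (k + 1)).Dom) :
    (toClusterTower (GenTower.ofTerms L T) k).H gk φ Z =
      ∑ s ∈ terms L M Z, T k Z s ((gk (Fin.last k) : ℝ) : ℂ) (olderOf (recTerm (GenTower.ofTerms L T) (histOfPrefix gk)) k) φ := by
  rw [toClusterTower_H]
  exact ofTerms_H L (T k) _ _ φ Z

open Classical in
/-- **THE W1 RECURSION WITH PRINT'S TERM SUM** — (2.13) at step `k + 1` literally: `E^{(k+1)}(X; g; φ) = locE (Z ↦ Σ_{(𝐃,P) ∈ terms L M Z}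
T k Z (𝐃,P) g_k (E^{(j)}(g))_{j≤k} φ) X`, the older terms the GENERATED ones. [cite: Balaban1988RG2Cluster, (2.13)-(2.14) pp.14-15; Balaban1987RG1, (2.12)-(2.13) p.268] -/
theorem recTerm_ofTerms_succ (T : GenTermFun P 𝔸 M L) (g : ℕ → ℂ) (k : ℕ) (X : (domSys P M (k + 1)).Dom) (φ : CPair P 𝔸) :
    recTerm (GenTower.ofTerms L T) g (k + 1) X φ =
      B13Resummation.locE (tgeometry P.d (domCount P M (k + 1))).ι (tgeometry P.d (domCount P M (k + 1))).cubes
        (fun Z => ∑ s ∈ terms L M Z, T k Z s (g k) (olderOf (recTerm (GenTower.ofTerms L T) g) k) φ) (Subtype.val X) := by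
  rw [recTerm_succ]
  exact ofTerms_E L (T k) _ _ φ X

/-- **SAME GENERATED HISTORY** (universality, tower level): if at every step the index maps send the indices at `Z` into `terms L M Z`, the tower of the
fibre term functionals generates the same terms `E^{(j)}(X; g; φ)` as `G`, at every level and every complex history.
[cite: Balaban1987RG1, (0.23) p.256 and (2.12)-(2.13) p.268; Balaban1988RG2Cluster, (2.13) p.14] -/
theorem recTerm_ofTerms_fibreTermFun (G : GenTower P 𝔸 M) (e : (k : ℕ) → (domSys P M (k + 1)).Dom → (G k).Idx → TermLabel P M k L)
    (he : ∀ (k : ℕ) (Z : (domSys P M (k + 1)).Dom), ∀ i ∈ (G k).idx Z, e k Z i ∈ terms L M Z) (g : ℕ → ℂ) :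
    ∀ (j : ℕ) (X : (domSys P M j).Dom) (φ : CPair P 𝔸),
      recTerm (GenTower.ofTerms L fun k => (G k).fibreTermFun L (e k)) g j X φ = recTerm G g j X φ := by
  intro j
  induction j using Nat.strong_induction_on with
  | _ j ih =>
    intro X φ
    cases j with
    | zero => simp
    | succ k =>
      rw [recTerm_succ, recTerm_succ]
      have hold : olderOf (recTerm (GenTower.ofTerms L fun k => (G k).fibreTermFun L (e k)) g) k = olderOf (recTerm G g) k :=
        funext fun j' => funext fun Y => funext fun ψ => by
          rw [olderOf_apply, olderOf_apply]
          exact ih j'.1 j'.2 Y ψ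
      rw [hold]
      exact E_ofTerms_fibreTermFun L (G k) (e k) (he k) (g k) _ φ X

end Towers

/-! ## §5  Honesty: at the zero term functional everything generated vanishes -/

section Honesty

variable {P : Params} {𝔸 : Type*} {M : ℕ} [NeZero M] {k : ℕ} (L : ℕ) [NeZero L]

/-- At the zero term functional the activities vanish. [cite: Balaban1988RG2Cluster, (2.11) p.14 (bookkeeping; the zero instance)] -/
theorem ofTerms_zero_H (t : ℂ) (old : OlderTerms P 𝔸 M k) (φ : CPair P 𝔸) (Z : (domSys P M (k + 1)).Dom) :
    (StepGen.ofTerms L (0 : TermFun P 𝔸 M k L)).H t old φ Z = 0 := by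
  rw [ofTerms_H]
  exact Finset.sum_eq_zero fun _ _ => rfl

open Classical in
/-- At the zero term functional every (2.13) vanishes (read off g2's termless step: the Kotecký–Preiss literal of the zero activity is `0`).
[cite: Balaban1988RG2Cluster, (2.13) p.14 (bookkeeping; the zero instance)] -/
theorem ofTerms_zero_E (t : ℂ) (old : OlderTerms P 𝔸 M k) (φ : CPair P 𝔸) (X : (domSys P M (k + 1)).Dom) :
    (StepGen.ofTerms L (0 : TermFun P 𝔸 M k L)).E t old φ X = 0 := by
  have h := E_termlessTower (P := P) (𝔸 := 𝔸) (M := M) k (fun _ => 0) φ X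
  rw [ClusterStep.E_eq_locE] at h
  refine Eq.trans ?_ h
  unfold StepGen.E
  exact B13Resummation.locE_congr _ fun Z _ => by rw [ofTerms_zero_H, H_termlessTower]

/-- **HONESTY — THE ZERO-TOWER SPECIES IN THIS CURRENCY**: at the zero term-functional family EVERY GENERATED TERM `E^{(j)}(X; g; φ)` vanishes, at every
level and every complex history — the junction pins the index set and the shape of the dependence, nothing analytic; the content of nodes N22 ∕ N10 is the
term functional OF RECORD. [cite: Balaban1987RG1, (0.23) p.256 and (2.13) p.268; Balaban1988RG2Cluster, (2.13)-(2.14) pp.14-15] -/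
theorem recTerm_ofTerms_zero (g : ℕ → ℂ) :
    ∀ (j : ℕ) (X : (domSys P M j).Dom) (φ : CPair P 𝔸), recTerm (GenTower.ofTerms L (0 : GenTermFun P 𝔸 M L)) g j X φ = 0
  | 0, X, φ => by simp
  | k + 1, X, φ => by
    rw [recTerm_succ, GenTower.ofTerms_apply]
    exact ofTerms_zero_E L (k := k) (g k) _ φ X

/-- The generated tower of the zero term-functional family has vanishing terms at every real history (g0's reading).
[cite: Balaban1987RG1, (0.23) p.256 and (2.13) p.268 (bookkeeping)] -/
theorem termC_toClusterTower_ofTerms_zero (g : ℕ → ℝ) (j : ℕ) (X : (domSys P M j).Dom) (φ : CPair P 𝔸) :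
    termC (toClusterTower (GenTower.ofTerms L (0 : GenTermFun P 𝔸 M L))) j X g φ = 0 := by
  rw [termC_toClusterTower]
  exact recTerm_ofTerms_zero L _ j X φ

end Honesty

end W1

end Literature.MathematicalPhysics.QuantumFieldTheory.Balaban1983to89.Node00
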